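import Summits.Ventures.CertifiedManyBodySolver.Downfold.TperpSeamSharp
import Summits.Ventures.CertifiedManyBodySolver.Downfold.BoxesYBCO7
import Summits.Ventures.CertifiedManyBodySolver.Certificates.HubbardSquare_affwords_sandwich_YBCO7
import HarnessLib

/-!
# Seam ENTRY POINTS on the typed YBa₂Cu₃O₆.₉₂ box `boxYBCO7M_M18` (bilayer cuprate, object M): the interlayer seams
# (vertical, every-pattern, SHARP vertical, and hubbard-box-p1's BILAYER seam) keyed on the box's `tperp/t` row

Venture CertifiedManyBodySolver, cell `pub/hubbard-downfold` (stage S1 ↔ S2 seam), seat hubbard-downfold-mod-1; namespace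
`Summit.Ventures.CertifiedManyBodySolver.Downfold`. `boxYBCO7M_M18` (`BoxesYBCO7.lean`: `U/t ∈ [5.8, 14.8] × tp/t ∈ [−0.30, −0.19] × n ∈ [0.815, 0.860]`,
`tperp/t ∈ [0.30, 0.45]` = the ON-TOP vertical amplitude t⊥₀/t of the box of record #106, `tpp/t ∈ [0.16, 0.27]`) is the first typed BILAYER
cuprate box. No S2 window covers its `(tp/t, n)` cell yet (hubbard-box-p2's U-uniform slabs stop at `n ≥ 0.83`, `tp/t ≤ −0.2`), so this file lands
the WINDOW-PARAMETRIC entry points only — any future `_word_Icc` statement on `Set.Icc ![29/5, -3/10, 163/200] ![74/5, -19/100, 43/50]` becomes a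
word on the box with one line:

* `boxYBCO7M_M18_layeredEnergyWord` — simple-tetragonal stacking, constant 2: `[L − 2·(9/20), R]`;
* `boxYBCO7M_M18_layeredEnergyWord_sharp` — the same with hubbard-box-p1's sharp constant: `[L − (4/π)·(9/20), R]`;
* `boxYBCO7M_M18_layeredEnergyWord_pattern` — every interlayer pattern with `Σ_b |tz_b| ≤ |p tperp/t|`;
* `boxYBCO7M_M18_bilayerEnergyWord` — hubbard-box-p1's BILAYER seam (`holdsOn_bilayerHubbardTTPrime_of_window`: stacking period 2, intra-bilayer
  vertical amplitude `p tperp/t`, inter-bilayer `t⊥'` with `|t⊥'| ≤ |p tperp/t|` — the box's inter-cell row `t_z/t ∈ [0, 0.23]` is admissible since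
  `p tperp/t ≥ 0.30`): window `[L − 2·(9/20), R]` for the variational cell energy over period-2 periodic states at cell filling `p n`.

(The object-M `t''` seam entry points `boxYBCO7M_M18_energyWord_kinematic/_four` are in `BoxesYBCO7.lean`.) HONEST FRAMING: entry points only — no
number about YBCO is stated here until an S2 window is plugged in; energy words only; the box is S1's screening-grade interval set (U = Y-123-family
class transfer per R-ch; `tperp/t` typed as the on-top amplitude — a stated modelling choice); nothing about order, pairing, `T_c` or a phase word.
Everything is PROVED; no definition, no `sorry`.
-/

noncomputable section

namespace Summit.Ventures.CertifiedManyBodySolver.Downfold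

open NonemptyInterval Literature.MathematicalPhysics.QuantumLattice
  Literature.MathematicalPhysics.QuantumLattice.ThermodynamicLimit Literature.Probability.LatticeModels

/-- The `tperp/t` magnitude of `boxYBCO7M_M18`: `max |3/10| |9/20| = 9/20`. [folklore] -/
theorem yBCO7M_M18_tperp_abs : (max |yBCO7M_M18_tperp.encl.fst| |yBCO7M_M18_tperp.encl.snd| : ℚ) = 9/20 := by
  rw [yBCO7M_M18_tperp, Entry.encl_ofEnds_fst, Entry.encl_ofEnds_snd, abs_of_nonneg (by norm_num), abs_of_nonneg (by norm_num)]
  norm_num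

/-- **Layered-crystal entry point on `boxYBCO7M_M18`, simple tetragonal stacking (constant 2):** an S2 window `[L, R]` on the cell
`Set.Icc ![29/5, -3/10, 163/200] ![74/5, -19/100, 43/50]` gives `L − 2·(9/20) ≤ e_{p n}(vertical crystal) ≤ R` on the box. [folklore] -/
theorem boxYBCO7M_M18_layeredEnergyWord {L R : ℝ}
    (hE : ∀ θ ∈ Set.Icc (![29/5, -3/10, 163/200] : Fin 3 → ℝ) ![74/5, -19/100, 43/50],
      L ≤ energyDensityTT' 1 (θ 1) (θ 0) (θ 2) ∧ energyDensityTT' 1 (θ 1) (θ 0) (θ 2) ≤ R) :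
    HoldsOn (fun p : OneBandCoord → ℝ =>
      L - 2 * (9/20 : ℝ) ≤
          (layeredHubbardTTPrime 1 (p .tpOverT) (p .UOverT) (fun _ : Fin 1 => (unitVec (0 : Fin 3) : Site 3))
            fun _ => p .tperpOverT).tiGroundEnergyDensityAt 1 (p .filling) ∧
        (layeredHubbardTTPrime 1 (p .tpOverT) (p .UOverT) (fun _ : Fin 1 => (unitVec (0 : Fin 3) : Site 3))
            fun _ => p .tperpOverT).tiGroundEnergyDensityAt 1 (p .filling) ≤ R) boxYBCO7M_M18 := by
  have h := holdsOn_verticalHubbardTTPrime_of_window (B := boxYBCO7M_M18) (eU := yBCO7M_M18_U) (eS := yBCO7M_M18_tp)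
    (eN := yBCO7M_M18_n) (eZ := yBCO7M_M18_tperp) rfl rfl rfl rfl
    (by rw [yBCO7M_M18_U, Entry.encl_ofEnds_fst]; norm_num)
    (by rw [yBCO7M_M18_n, Entry.encl_ofEnds_fst]; norm_num)
    (by rw [yBCO7M_M18_n, Entry.encl_ofEnds_snd]; norm_num)
    (L := L) (R := R) (by rw [yBCO7M_M18_s2Lo, yBCO7M_M18_s2Hi]; exact hE)
  rw [yBCO7M_M18_tperp_abs] at h
  have hc : (((9/20 : ℚ)) : ℝ) = (9/20 : ℝ) := by norm_num
  rw [hc] at h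
  exact h

/-- **SHARP layered-crystal entry point on `boxYBCO7M_M18`** (hubbard-box-p1's constant `4/π`): `L − (4/π)·(9/20) ≤ e ≤ R`. [folklore] -/
theorem boxYBCO7M_M18_layeredEnergyWord_sharp {L R : ℝ}
    (hE : ∀ θ ∈ Set.Icc (![29/5, -3/10, 163/200] : Fin 3 → ℝ) ![74/5, -19/100, 43/50],
      L ≤ energyDensityTT' 1 (θ 1) (θ 0) (θ 2) ∧ energyDensityTT' 1 (θ 1) (θ 0) (θ 2) ≤ R) :
    HoldsOn (fun p : OneBandCoord → ℝ =>
      L - 4 / Real.pi * (9/20 : ℝ) ≤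
          (layeredHubbardTTPrime 1 (p .tpOverT) (p .UOverT) (fun _ : Fin 1 => (unitVec (0 : Fin 3) : Site 3))
            fun _ => p .tperpOverT).tiGroundEnergyDensityAt 1 (p .filling) ∧
        (layeredHubbardTTPrime 1 (p .tpOverT) (p .UOverT) (fun _ : Fin 1 => (unitVec (0 : Fin 3) : Site 3))
            fun _ => p .tperpOverT).tiGroundEnergyDensityAt 1 (p .filling) ≤ R) boxYBCO7M_M18 := by
  have h := holdsOn_verticalHubbardTTPrime_of_window_sharp (B := boxYBCO7M_M18) (eU := yBCO7M_M18_U) (eS := yBCO7M_M18_tp)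
    (eN := yBCO7M_M18_n) (eZ := yBCO7M_M18_tperp) rfl rfl rfl rfl
    (by rw [yBCO7M_M18_U, Entry.encl_ofEnds_fst]; norm_num)
    (by rw [yBCO7M_M18_n, Entry.encl_ofEnds_fst]; norm_num)
    (by rw [yBCO7M_M18_n, Entry.encl_ofEnds_snd]; norm_num)
    (L := L) (R := R) (by rw [yBCO7M_M18_s2Lo, yBCO7M_M18_s2Hi]; exact hE)
  rw [yBCO7M_M18_tperp_abs] at h
  have hc : (((9/20 : ℚ)) : ℝ) = (9/20 : ℝ) := by norm_num
  rw [hc] at h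
  exact h

/-- **Layered-crystal entry point on `boxYBCO7M_M18`, EVERY interlayer pattern** (`(w_b)₀ ≠ 0`, range box `R' ≥ 1`, `Σ_b |tz_b| ≤ |p tperp/t|`):
`L − 2·(9/20) ≤ e_{p n}(layered crystal) ≤ R` on the box. [folklore] -/
theorem boxYBCO7M_M18_layeredEnergyWord_pattern {L R : ℝ}
    (hE : ∀ θ ∈ Set.Icc (![29/5, -3/10, 163/200] : Fin 3 → ℝ) ![74/5, -19/100, 43/50],
      L ≤ energyDensityTT' 1 (θ 1) (θ 0) (θ 2) ∧ energyDensityTT' 1 (θ 1) (θ 0) (θ 2) ≤ R)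
    {κ : Type*} [Fintype κ] {w : κ → Site 3} (hw : ∀ b, w b 0 ≠ 0) {R' : ℝ} (hR' : 1 ≤ R')
    (hwR' : ∀ b, w b ∈ thicken ({0} : Finset (Site 3)) R') :
    HoldsOn (fun p : OneBandCoord → ℝ => ∀ tz : κ → ℝ, ∑ b, |tz b| ≤ |p .tperpOverT| →
      L - 2 * (9/20 : ℝ) ≤
          (layeredHubbardTTPrime 1 (p .tpOverT) (p .UOverT) w tz).tiGroundEnergyDensityAt R' (p .filling) ∧
        (layeredHubbardTTPrime 1 (p .tpOverT) (p .UOverT) w tz).tiGroundEnergyDensityAt R' (p .filling) ≤ R)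
      boxYBCO7M_M18 := by
  have h := holdsOn_layeredHubbardTTPrime_of_window (B := boxYBCO7M_M18) (eU := yBCO7M_M18_U) (eS := yBCO7M_M18_tp)
    (eN := yBCO7M_M18_n) (eZ := yBCO7M_M18_tperp) rfl rfl rfl rfl
    (by rw [yBCO7M_M18_U, Entry.encl_ofEnds_fst]; norm_num)
    (by rw [yBCO7M_M18_n, Entry.encl_ofEnds_fst]; norm_num)
    (by rw [yBCO7M_M18_n, Entry.encl_ofEnds_snd]; norm_num)
    (L := L) (R := R) (by rw [yBCO7M_M18_s2Lo, yBCO7M_M18_s2Hi]; exact hE) hw hR' hwR'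
  rw [yBCO7M_M18_tperp_abs] at h
  have hc : (((9/20 : ℚ)) : ℝ) = (9/20 : ℝ) := by norm_num
  rw [hc] at h
  exact h

/-- **BILAYER entry point on `boxYBCO7M_M18`** (hubbard-box-p1's `holdsOn_bilayerHubbardTTPrime_of_window`: stacking period 2, intra-bilayer vertical
amplitude `p tperp/t`, inter-bilayer `t⊥'` with `|t⊥'| ≤ |p tperp/t|`): an S2 window `[L, R]` on the cell gives, at every member and every such `t⊥'`,
`L − 2·(9/20) ≤` (variational cell energy of the bilayer crystal over period-2 periodic states at cell filling `p n`) `≤ R`. [folklore] -/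
theorem boxYBCO7M_M18_bilayerEnergyWord {L R : ℝ}
    (hE : ∀ θ ∈ Set.Icc (![29/5, -3/10, 163/200] : Fin 3 → ℝ) ![74/5, -19/100, 43/50],
      L ≤ energyDensityTT' 1 (θ 1) (θ 0) (θ 2) ∧ energyDensityTT' 1 (θ 1) (θ 0) (θ 2) ≤ R) :
    HoldsOn (fun p : OneBandCoord → ℝ => ∀ tperp' : ℝ, |tperp'| ≤ |p .tperpOverT| →
      L - 2 * (9/20 : ℝ) ≤
          infCellEnergyOn (periodicStatesAt (stackPeriods 2 1) (p .filling))
            (periodicLayeredHubbardTTPrimeViews 1 1 (p .tpOverT) (p .UOverT)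
              (fun _ : Fin 1 => (unitVec (0 : Fin 3) : Site 3)) fun j _ => ![p .tperpOverT, tperp'] j) 1 ∧
        infCellEnergyOn (periodicStatesAt (stackPeriods 2 1) (p .filling))
            (periodicLayeredHubbardTTPrimeViews 1 1 (p .tpOverT) (p .UOverT)
              (fun _ : Fin 1 => (unitVec (0 : Fin 3) : Site 3)) fun j _ => ![p .tperpOverT, tperp'] j) 1 ≤ R)
      boxYBCO7M_M18 := by
  have h := holdsOn_bilayerHubbardTTPrime_of_window (B := boxYBCO7M_M18) (eU := yBCO7M_M18_U) (eS := yBCO7M_M18_tp)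
    (eN := yBCO7M_M18_n) (eZ := yBCO7M_M18_tperp) rfl rfl rfl rfl
    (by rw [yBCO7M_M18_U, Entry.encl_ofEnds_fst]; norm_num)
    (by rw [yBCO7M_M18_n, Entry.encl_ofEnds_fst]; norm_num)
    (by rw [yBCO7M_M18_n, Entry.encl_ofEnds_snd]; norm_num)
    (L := L) (R := R) (by rw [yBCO7M_M18_s2Lo, yBCO7M_M18_s2Hi]; exact hE)
  rw [yBCO7M_M18_tperp_abs] at h
  have hc : (((9/20 : ℚ)) : ℝ) = (9/20 : ℝ) := by norm_num
  rw [hc] at h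
  exact h

/-! ## Appendix (g8, 2026-08-27): FIRST WORDS on `boxYBCO7M_M18` — hubbard-box-p2's hypothesis-free U-uniform sandwich
`aw_ybco7M_M18_word` / `aw_ybco7M_M18_affword_Icc` (p520861, cell `U/t ∈ [0, 20] ⊇ [5.8, 14.8]`) through every entry point above

box-p2 answered the 09:45:44Z slab ask with `Certificates/HubbardSquare_affwords_sandwich_YBCO7.lean`: on
`Set.Icc ![0, -3/10, 163/200] ![20, -19/100, 43/50]`, `−1.5601315986 ≤ e₀(1, tp/t, U/t, n) ≤ −0.4945932713` (free Fermi-sea rows at the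
columns −3/10 / −17/100, polarised caps on [−3/10, −1/5] + cap sliver to −0.19), and the AFFINE edition
`−1.0339187871 − 0.0660366009·(tp/t) − 0.6264648438·n ≤ e₀ ≤ −2.4816027437 + 0.1473818182·(tp/t) + 2.3430372300·n`. Restricted to the box's
own cell (`yBCO7M_M18_sandwich_window`) it gives, with NO hypothesis:
* `boxYBCO7M_M18_word_sandwich_kinematic` / `_decimal` — the `t–t'–t''` OBJECT-M energy at the box's filling: `[−1.5601315986 − (16/π²)(27/100),
  −0.4945932713 + (16/π²)(27/100)] ⊆ [−1.999, −0.056]`;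
* `boxYBCO7M_M18_affword_sandwich` — the affine `t–t'` enclosure at the box's `(U/t, tp/t, n)` (the `t''` object differs by at most the same
  allowance `≤ 0.438` per side, `yBCO7M_M18_allowance_le`);
* `boxYBCO7M_M18_layered_word_sandwich` (constant 2: `[−1.5601315986 − 2·(9/20), −0.4945932713]`), `_sharp` (`4/π`; decimal `[−2.134, −0.4945932713]`),
  `_pattern` (every interlayer pattern), and `boxYBCO7M_M18_bilayer_word_sandwich` — the FIRST closed word on a typed BILAYER crystal
  (period-2 stacking, intra-bilayer `t⊥₀/t ∈ [0.30, 0.45]`, any inter-bilayer `|t⊥'| ≤ |t⊥₀/t|`): `[−2.4601315986, −0.4945932713]`.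
The conditional VARBOX word `aw_vbv_ybco7M_M18_word (hVB)` (p521071: `[−1.5594757993, −0.3970705257]`) is dominated on the cap and within `7·10⁻⁴`
on the floor, so it is not joined here. `boxYBCO7M_M130` (n ∈ [0.78, 0.83]) is not inside the slab (n ≥ 0.815) and still carries entry points only.
HONEST FRAMING: energy words only (screening-grade S1 box × certified S2 window); the interlayer floors are the generic `2·|t⊥|` / `(4/π)·|t⊥|`
allowances, loose by design; nothing about order, pairing, `T_c` or a phase word.
-/

/-- box-p2's U-uniform sandwich word `aw_ybco7M_M18_word` (cell `U/t ∈ [0, 20]`) RESTRICTED to the delivered cell of `boxYBCO7M_M18`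
(`Set.Icc ![29/5, -3/10, 163/200] ![74/5, -19/100, 43/50]`): `−1.5601315986 ≤ e₀ ≤ −0.4945932713`. [cite: Neumaier2004CompleteSearch, §12] -/
theorem yBCO7M_M18_sandwich_window :
    ∀ θ ∈ Set.Icc (![29/5, -3/10, 163/200] : Fin 3 → ℝ) ![74/5, -19/100, 43/50],
      (-1.5601315986 : ℝ) ≤ energyDensityTT' 1 (θ 1) (θ 0) (θ 2) ∧ energyDensityTT' 1 (θ 1) (θ 0) (θ 2) ≤ (-0.4945932713 : ℝ) :=
  forall_mem_Icc_vec3_mono (P := fun θ => (-1.5601315986 : ℝ) ≤ energyDensityTT' 1 (θ 1) (θ 0) (θ 2) ∧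
      energyDensityTT' 1 (θ 1) (θ 0) (θ 2) ≤ (-0.4945932713 : ℝ))
    (a₀' := (29/5 : ℝ)) (a₁' := (-3/10 : ℝ)) (a₂' := (163/200 : ℝ)) (b₀' := (74/5 : ℝ)) (b₁' := (-19/100 : ℝ)) (b₂' := (43/50 : ℝ))
    Summit.Ventures.CertifiedManyBodySolver.Certificates.aw_ybco7M_M18_word
    (by norm_num) (by norm_num) (by norm_num) (by norm_num) (by norm_num) (by norm_num)

/-- box-p2's AFFINE sandwich word `aw_ybco7M_M18_affword_Icc` RESTRICTED to the delivered cell of `boxYBCO7M_M18`. [cite: Neumaier2004CompleteSearch, §12] -/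
theorem yBCO7M_M18_sandwich_affWindow :
    ∀ θ ∈ Set.Icc (![29/5, -3/10, 163/200] : Fin 3 → ℝ) ![74/5, -19/100, 43/50],
      (-1.0339187871 : ℝ) + (0 : ℝ) * θ 0 + (-0.0660366009 : ℝ) * θ 1 + (-0.6264648438 : ℝ) * θ 2 ≤ energyDensityTT' 1 (θ 1) (θ 0) (θ 2) ∧
        energyDensityTT' 1 (θ 1) (θ 0) (θ 2) ≤ (-2.4816027437 : ℝ) + (0 : ℝ) * θ 0 + (0.1473818182 : ℝ) * θ 1 + (2.3430372300 : ℝ) * θ 2 :=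
  forall_mem_Icc_vec3_mono (P := fun θ =>
      (-1.0339187871 : ℝ) + (0 : ℝ) * θ 0 + (-0.0660366009 : ℝ) * θ 1 + (-0.6264648438 : ℝ) * θ 2 ≤ energyDensityTT' 1 (θ 1) (θ 0) (θ 2) ∧
        energyDensityTT' 1 (θ 1) (θ 0) (θ 2) ≤ (-2.4816027437 : ℝ) + (0 : ℝ) * θ 0 + (0.1473818182 : ℝ) * θ 1 + (2.3430372300 : ℝ) * θ 2)
    (a₀' := (29/5 : ℝ)) (a₁' := (-3/10 : ℝ)) (a₂' := (163/200 : ℝ)) (b₀' := (74/5 : ℝ)) (b₁' := (-19/100 : ℝ)) (b₂' := (43/50 : ℝ))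
    Summit.Ventures.CertifiedManyBodySolver.Certificates.aw_ybco7M_M18_affword_Icc
    (by norm_num) (by norm_num) (by norm_num) (by norm_num) (by norm_num) (by norm_num)

/-- **Hypothesis-free OBJECT-M word on `boxYBCO7M_M18`** (YBa₂Cu₃O₆.₉₂, #18): the fixed-filling energy density of the `t–t'–t''` object lies in
`[−1.5601315986 − (16/π²)(27/100), −0.4945932713 + (16/π²)(27/100)]` (`aw_ybco7M_M18_word` through `boxYBCO7M_M18_energyWord_kinematic`).
[cite: LiebLoss1993, §8, Theorem 8.2] -/
theorem boxYBCO7M_M18_word_sandwich_kinematic :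
    HoldsOn (fun p : OneBandCoord → ℝ =>
      (-1.5601315986 : ℝ) - 16 / Real.pi ^ 2 * (27/100 : ℝ) ≤
          (hubbardTT'T''FermionInteraction 1 (p .tpOverT) (p .tppOverT) (p .UOverT)).tiGroundEnergyDensityAt
            2 (p .filling) ∧
        (hubbardTT'T''FermionInteraction 1 (p .tpOverT) (p .tppOverT) (p .UOverT)).tiGroundEnergyDensityAt
            2 (p .filling) ≤
          (-0.4945932713 : ℝ) + 16 / Real.pi ^ 2 * (27/100 : ℝ)) boxYBCO7M_M18 :=
  boxYBCO7M_M18_energyWord_kinematic yBCO7M_M18_sandwich_window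

/-- **Decimal enclosure on `boxYBCO7M_M18`** (object M): `−1.999 ≤ e^M_n ≤ −0.056` (allowance `(16/π²)(27/100) ≤ 0.438`, `yBCO7M_M18_allowance_le`). [folklore] -/
theorem boxYBCO7M_M18_word_sandwich_decimal :
    HoldsOn (fun p : OneBandCoord → ℝ =>
      (-1.999 : ℝ) ≤
          (hubbardTT'T''FermionInteraction 1 (p .tpOverT) (p .tppOverT) (p .UOverT)).tiGroundEnergyDensityAt
            2 (p .filling) ∧
        (hubbardTT'T''FermionInteraction 1 (p .tpOverT) (p .tppOverT) (p .UOverT)).tiGroundEnergyDensityAt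
            2 (p .filling) ≤ (-0.056 : ℝ)) boxYBCO7M_M18 := by
  refine boxYBCO7M_M18_word_sandwich_kinematic.mono fun p hp => ?_
  have ha := yBCO7M_M18_allowance_le
  constructor
  · linarith [hp.1]
  · linarith [hp.2]

/-- **Hypothesis-free AFFINE `t–t'` enclosure at the box's `(U/t, tp/t, n)` on `boxYBCO7M_M18`** (`aw_ybco7M_M18_affword_Icc` through the seam):
`−1.0339187871 − 0.0660366009·(tp/t) − 0.6264648438·n ≤ e₀(1, tp/t, U/t, n) ≤ −2.4816027437 + 0.1473818182·(tp/t) + 2.3430372300·n` at every member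
(the `t–t'–t''` object's energy differs from `e₀` by at most `(16/π²)(27/100) ≤ 0.438` per side). [cite: Neumaier2004CompleteSearch, §12] -/
theorem boxYBCO7M_M18_affword_sandwich :
    HoldsOn (fun p : OneBandCoord → ℝ =>
      (-1.0339187871 : ℝ) + (0 : ℝ) * p .UOverT + (-0.0660366009 : ℝ) * p .tpOverT + (-0.6264648438 : ℝ) * p .filling ≤
          energyDensityTT' 1 (p .tpOverT) (p .UOverT) (p .filling) ∧
        energyDensityTT' 1 (p .tpOverT) (p .UOverT) (p .filling) ≤
          (-2.4816027437 : ℝ) + (0 : ℝ) * p .UOverT + (0.1473818182 : ℝ) * p .tpOverT + (2.3430372300 : ℝ) * p .filling) boxYBCO7M_M18 := by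
  have h := holdsOn_of_forall_s2Box (B := boxYBCO7M_M18) (eU := yBCO7M_M18_U) (eS := yBCO7M_M18_tp)
    (eN := yBCO7M_M18_n) rfl rfl rfl
    (W := fun θ => (-1.0339187871 : ℝ) + (0 : ℝ) * θ 0 + (-0.0660366009 : ℝ) * θ 1 + (-0.6264648438 : ℝ) * θ 2 ≤ energyDensityTT' 1 (θ 1) (θ 0) (θ 2) ∧
        energyDensityTT' 1 (θ 1) (θ 0) (θ 2) ≤ (-2.4816027437 : ℝ) + (0 : ℝ) * θ 0 + (0.1473818182 : ℝ) * θ 1 + (2.3430372300 : ℝ) * θ 2)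
    (by rw [yBCO7M_M18_s2Lo, yBCO7M_M18_s2Hi]; exact yBCO7M_M18_sandwich_affWindow)
  exact h

/-- **Hypothesis-free LAYERED word on `boxYBCO7M_M18`, simple tetragonal stacking (constant 2)**: the `t–t'–t_z` crystal's fixed-filling energy density lies in
`[−1.5601315986 − 2·(9/20), −0.4945932713] = [−2.4601315986, −0.4945932713]` at every member. [folklore] -/
theorem boxYBCO7M_M18_layered_word_sandwich :
    HoldsOn (fun p : OneBandCoord → ℝ =>
      (-1.5601315986 : ℝ) - 2 * (9/20 : ℝ) ≤
          (layeredHubbardTTPrime 1 (p .tpOverT) (p .UOverT) (fun _ : Fin 1 => (unitVec (0 : Fin 3) : Site 3))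
            fun _ => p .tperpOverT).tiGroundEnergyDensityAt 1 (p .filling) ∧
        (layeredHubbardTTPrime 1 (p .tpOverT) (p .UOverT) (fun _ : Fin 1 => (unitVec (0 : Fin 3) : Site 3))
            fun _ => p .tperpOverT).tiGroundEnergyDensityAt 1 (p .filling) ≤ (-0.4945932713 : ℝ)) boxYBCO7M_M18 :=
  boxYBCO7M_M18_layeredEnergyWord yBCO7M_M18_sandwich_window

/-- **The sharp interlayer allowance of `boxYBCO7M_M18` in decimals**: `(4/π)·(9/20) ≤ 0.573`. [folklore] -/
theorem yBCO7M_M18_tperp_allowance_sharp_le : 4 / Real.pi * (9/20 : ℝ) ≤ 0.573 := by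
  have hπ := Real.pi_gt_d6
  rw [div_mul_eq_mul_div, div_le_iff₀ Real.pi_pos]
  nlinarith

/-- **Hypothesis-free SHARP layered word on `boxYBCO7M_M18`** (hubbard-box-p1's constant `4/π`): `[−1.5601315986 − (4/π)(9/20), −0.4945932713]`. [folklore] -/
theorem boxYBCO7M_M18_layered_word_sandwich_sharp :
    HoldsOn (fun p : OneBandCoord → ℝ =>
      (-1.5601315986 : ℝ) - 4 / Real.pi * (9/20 : ℝ) ≤
          (layeredHubbardTTPrime 1 (p .tpOverT) (p .UOverT) (fun _ : Fin 1 => (unitVec (0 : Fin 3) : Site 3))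
            fun _ => p .tperpOverT).tiGroundEnergyDensityAt 1 (p .filling) ∧
        (layeredHubbardTTPrime 1 (p .tpOverT) (p .UOverT) (fun _ : Fin 1 => (unitVec (0 : Fin 3) : Site 3))
            fun _ => p .tperpOverT).tiGroundEnergyDensityAt 1 (p .filling) ≤ (-0.4945932713 : ℝ)) boxYBCO7M_M18 :=
  boxYBCO7M_M18_layeredEnergyWord_sharp yBCO7M_M18_sandwich_window

/-- **Decimal enclosure of the sharp layered word on `boxYBCO7M_M18`**: `−2.134 ≤ e_{p n}(vertical crystal) ≤ −0.4945932713`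
(vs `−2.4601315986` at the constant 2). [folklore] -/
theorem boxYBCO7M_M18_layered_word_sandwich_sharp_decimal :
    HoldsOn (fun p : OneBandCoord → ℝ =>
      (-2.134 : ℝ) ≤
          (layeredHubbardTTPrime 1 (p .tpOverT) (p .UOverT) (fun _ : Fin 1 => (unitVec (0 : Fin 3) : Site 3))
            fun _ => p .tperpOverT).tiGroundEnergyDensityAt 1 (p .filling) ∧
        (layeredHubbardTTPrime 1 (p .tpOverT) (p .UOverT) (fun _ : Fin 1 => (unitVec (0 : Fin 3) : Site 3))
            fun _ => p .tperpOverT).tiGroundEnergyDensityAt 1 (p .filling) ≤ (-0.4945932713 : ℝ)) boxYBCO7M_M18 := by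
  refine boxYBCO7M_M18_layered_word_sandwich_sharp.mono fun p hp => ?_
  have ha := yBCO7M_M18_tperp_allowance_sharp_le
  constructor
  · linarith [hp.1]
  · exact hp.2

/-- **Hypothesis-free LAYERED word on `boxYBCO7M_M18`, EVERY interlayer pattern** (vectors `w_b` with `(w_b)₀ ≠ 0` in a range box `R' ≥ 1`,
amplitudes with `Σ_b |tz_b| ≤ |p tperp/t|`): `[−1.5601315986 − 2·(9/20), −0.4945932713]`. [folklore] -/
theorem boxYBCO7M_M18_layered_word_sandwich_pattern {κ : Type*} [Fintype κ] {w : κ → Site 3} (hw : ∀ b, w b 0 ≠ 0)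
    {R' : ℝ} (hR' : 1 ≤ R') (hwR' : ∀ b, w b ∈ thicken ({0} : Finset (Site 3)) R') :
    HoldsOn (fun p : OneBandCoord → ℝ => ∀ tz : κ → ℝ, ∑ b, |tz b| ≤ |p .tperpOverT| →
      (-1.5601315986 : ℝ) - 2 * (9/20 : ℝ) ≤
          (layeredHubbardTTPrime 1 (p .tpOverT) (p .UOverT) w tz).tiGroundEnergyDensityAt R' (p .filling) ∧
        (layeredHubbardTTPrime 1 (p .tpOverT) (p .UOverT) w tz).tiGroundEnergyDensityAt R' (p .filling) ≤
          (-0.4945932713 : ℝ)) boxYBCO7M_M18 :=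
  boxYBCO7M_M18_layeredEnergyWord_pattern yBCO7M_M18_sandwich_window hw hR' hwR'

/-- **FIRST CLOSED WORD ON A TYPED BILAYER CRYSTAL — `boxYBCO7M_M18`** (hubbard-box-p1's bilayer seam `holdsOn_bilayerHubbardTTPrime_of_window`:
stacking period 2, intra-bilayer vertical amplitude `p tperp/t ∈ [0.30, 0.45]`, any inter-bilayer `t⊥'` with `|t⊥'| ≤ |p tperp/t|`): at every member
the variational cell energy over period-2 periodic states at cell filling `p n` lies in `[−1.5601315986 − 2·(9/20), −0.4945932713]`. [folklore] -/
theorem boxYBCO7M_M18_bilayer_word_sandwich :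
    HoldsOn (fun p : OneBandCoord → ℝ => ∀ tperp' : ℝ, |tperp'| ≤ |p .tperpOverT| →
      (-1.5601315986 : ℝ) - 2 * (9/20 : ℝ) ≤
          infCellEnergyOn (periodicStatesAt (stackPeriods 2 1) (p .filling))
            (periodicLayeredHubbardTTPrimeViews 1 1 (p .tpOverT) (p .UOverT)
              (fun _ : Fin 1 => (unitVec (0 : Fin 3) : Site 3)) fun j _ => ![p .tperpOverT, tperp'] j) 1 ∧
        infCellEnergyOn (periodicStatesAt (stackPeriods 2 1) (p .filling))
            (periodicLayeredHubbardTTPrimeViews 1 1 (p .tpOverT) (p .UOverT)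
              (fun _ : Fin 1 => (unitVec (0 : Fin 3) : Site 3)) fun j _ => ![p .tperpOverT, tperp'] j) 1 ≤ (-0.4945932713 : ℝ))
      boxYBCO7M_M18 :=
  boxYBCO7M_M18_bilayerEnergyWord yBCO7M_M18_sandwich_window

end Summit.Ventures.CertifiedManyBodySolver.Downfold

end
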